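import Literature.Barriers.AtomisticToContinuum.OneDimensionalHardCoreToeplitz
import HarnessLib

/-!
# No off-diagonal long-range order for the Girardeau gas: the pointwise `r^{-1/2}` bound

`Literature/Barriers/AtomisticToContinuum` (D-0021 barrier catalogue, conjunct
`BoseEinsteinCondensation`). Companion of `OneDimensionalHardCore.lean` (fifteenth audit,
2026-08-16): the Penrose–Onsager (coordinate-space) form of the catalogued obstruction
`OneDimensionalHardCore` (`c₀(N)/N → 0`), as ALL-`N` inequalities for the one-body density matrix
`girardeauDensityMatrix N L x y = ρ_N(x, y)` of Girardeau's ground state of `N` impenetrable bosons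
on a ring of circumference `L`:

* `girardeauDensityMatrix_le_sqrt_div_sin` — the pointwise Szegő–Lenard bound
  `ρ_N(a, b) ≤ 2e√N / (L √|sin(π(a − b)/L)|)` (Lenard's Toeplitz formula
  `ρ_{n+1}(a, b) = L⁻¹ R(n, 2π(a − b)/L)` and Szegő's inequality `R(n, t) ≤ 2e√(n+1)/√|sin(t/2)|`,
  both theorems of `OneDimensionalHardCoreToeplitz.lean`);
* `girardeauDensityMatrix_le_sqrt_density_div` — hence, for `0 < |a − b| ≤ L/2` (the ring
  distance), `ρ_N(a, b) ≤ e √(2ρ̄/|a − b|)` with `ρ̄ = N/L` the density: the printed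
  thermodynamic-limit law `ρ(x) ∼ ρ_∞ ρ̄ (ρ̄|x|)^{-1/2}` [ForresterEtAl2003, §2.1.4] as a uniform
  upper bound of the same order, valid for every `N`, `L` — in particular `ρ_N(x, y) → 0` as
  `|x − y| → ∞` uniformly in `N` at fixed density (no ODLRO in the sense of Penrose–Onsager
  [PenroseOnsager1956, §4]), with the algebraic exponent `1/2`;
* `girardeauDensityMatrix_antipodal_le` — the antipodal coherence is `ρ_N(a, a + L/2) ≤ 2eρ̄/√N`;
* `tendsto_girardeauDensityMatrix_antipodal` — so along the thermodynamic limit `L = N/ρ` the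
  antipodal coherence tends to `0`.

What this adds to the typed barrier: the momentum-space statements of the catalogue
(`c₀(N)/N → 0`; `c₀(N) ≤ 4e√N`; bands) refute lower bounds on INTEGRATED coherence; the bounds
here refute POINTWISE long-range-order conclusions (`ρ_N(x, y) ≥ cρ̄` at a fixed or maximal
separation, or quasi-order `ρ_N ≥ cρ̄(ρ̄|x − y|)^{-α}` with `α < 1/2`) directly, for mechanisms that
would apply verbatim to the impenetrable one-dimensional gas.

## References

* [ForresterEtAl2003] P. J. Forrester, N. E. Frankel, T. M. Garoni, N. S. Witte, Phys. Rev. A 67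
  (2003) 043607, arXiv:cond-mat/0211126: §2.1.4 (`Lρ_N^C(x) ∼ ρ_∞√N|sin(πx/L)|^{-1/2}`).
* [Lenard1964] A. Lenard, J. Math. Phys. 5 (1964) 930–943 (Szegő's inequality; cite-only, as
  restated in [DeiftItsKrasovsky2013, Remark 8 (r34-2)]).
* [DeiftItsKrasovsky2013] P. Deift, A. Its, I. Krasovsky, Comm. Pure Appl. Math. 66 (2013)
  1360–1438, arXiv:1207.4990: Remark 8.
* [PenroseOnsager1956] O. Penrose, L. Onsager, Phys. Rev. 104 (1956) 576–584: §4 (the criterion).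
-/

noncomputable section

open Filter Topology Real

namespace Literature.Barriers.AtomisticToContinuum.BoseGas

/-- **Pointwise Szegő–Lenard bound for the density matrix of the Girardeau gas**:
`ρ_N(a, b) ≤ 2e√N / (L√|sin(π(a − b)/L)|)` for every `N ≥ 1`, `L > 0` and all `a, b` off the
diagonal set `a − b ∈ Lℤ` — Lenard's Toeplitz formula combined with Szegő's inequality
`|R_N(t)| ≤ (eN/|sin(t/2)|)^{1/2}` (here with the tree's constant `2e`).
[cite: DeiftItsKrasovsky2013, Remark 8 (r34-2)] [cite: ForresterEtAl2003, §2.1.4] -/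
theorem girardeauDensityMatrix_le_sqrt_div_sin {N : ℕ} (hN : 1 ≤ N) {L : ℝ} (hL : 0 < L)
    {a b : ℝ} (h : Real.sin (π * (a - b) / L) ≠ 0) :
    girardeauDensityMatrix N L a b ≤
      2 * Real.exp 1 * Real.sqrt N / (L * Real.sqrt |Real.sin (π * (a - b) / L)|) := by
  obtain ⟨n, rfl⟩ : ∃ n, N = n + 1 := ⟨N - 1, by omega⟩
  rw [girardeauDensityMatrix_eq_lenardDet hL a b]
  have harg : 2 * π * (a - b) / L / 2 = π * (a - b) / L := by ring
  have ht : Real.sin (2 * π * (a - b) / L / 2) ≠ 0 := by rwa [harg]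
  have hle := lenardDet_le_sqrt n ht
  rw [harg] at hle
  have hs : 0 < Real.sqrt |Real.sin (π * (a - b) / L)| := Real.sqrt_pos.2 (abs_pos.2 h)
  calc L⁻¹ * lenardDet n (2 * π * (a - b) / L)
      ≤ L⁻¹ * (2 * Real.exp 1 * Real.sqrt (n + 1) / Real.sqrt |Real.sin (π * (a - b) / L)|) :=
        mul_le_mul_of_nonneg_left hle (inv_nonneg.2 hL.le)
    _ = 2 * Real.exp 1 * Real.sqrt (((n + 1 : ℕ) : ℝ)) /
          (L * Real.sqrt |Real.sin (π * (a - b) / L)|) := by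
        push_cast
        field_simp

/-- **No off-diagonal long-range order (Penrose–Onsager form), with the exponent `1/2`**: for
`N ≥ 1` impenetrable bosons on a ring of circumference `L` and two points at ring distance
`0 < |a − b| ≤ L/2`, `ρ_N(a, b) ≤ e √(2ρ̄/|a − b|)`, `ρ̄ = N/L` — a uniform-in-`N` upper bound of
the order of the printed law `ρ(x) ∼ ρ_∞ ρ̄ (ρ̄|x|)^{-1/2}` (`ρ_∞ ≈ 0.924`); in particular the
density matrix tends to zero at large separation uniformly in `N` at fixed density.
[cite: ForresterEtAl2003, §2.1.4] [cite: PenroseOnsager1956, §4] -/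
theorem girardeauDensityMatrix_le_sqrt_density_div {N : ℕ} (hN : 1 ≤ N) {L : ℝ} (hL : 0 < L)
    {a b : ℝ} (h0 : a ≠ b) (h : |a - b| ≤ L / 2) :
    girardeauDensityMatrix N L a b ≤ Real.exp 1 * Real.sqrt (2 * (N / L) / |a - b|) := by
  have hd : 0 < |a - b| := abs_pos.2 (sub_ne_zero.2 h0)
  have habs : |π * (a - b) / L| = π * |a - b| / L := by
    rw [abs_div, abs_mul, abs_of_pos Real.pi_pos, abs_of_pos hL]
  have hx : |π * (a - b) / L| ≤ π / 2 := by
    rw [habs, div_le_iff₀ hL]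
    calc π * |a - b| ≤ π * (L / 2) := mul_le_mul_of_nonneg_left h Real.pi_pos.le
      _ = π / 2 * L := by ring
  -- Jordan's inequality in absolute value, `(2/π)|x| ≤ |sin x|` for `|x| ≤ π/2` (the same
  -- elementary lemma is `…GaussianInt.HeckeMVT.two_div_pi_mul_abs_le_abs_sin` in the
  -- number-theory corner of the tree; inlined here to keep this file's imports local).
  have hj : 2 / π * |π * (a - b) / L| ≤ |Real.sin (π * (a - b) / L)| := by
    generalize π * (a - b) / L = x at hx ⊢
    rcases le_or_gt 0 x with hx0 | hx0
    · rw [abs_of_nonneg hx0] at hx ⊢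
      exact (Real.mul_le_sin hx0 hx).trans (le_abs_self _)
    · have hx' : -x ≤ π / 2 := by rwa [abs_of_neg hx0] at hx
      rw [abs_of_neg hx0]
      calc 2 / π * -x ≤ Real.sin (-x) := Real.mul_le_sin (by linarith) hx'
        _ = -Real.sin x := Real.sin_neg x
        _ ≤ |Real.sin x| := neg_le_abs _
  have hsin : 2 * |a - b| / L ≤ |Real.sin (π * (a - b) / L)| := by
    calc 2 * |a - b| / L = 2 / π * |π * (a - b) / L| := by
          rw [habs]; field_simp
      _ ≤ _ := hj
  have hpos : 0 < 2 * |a - b| / L := by positivity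
  have hsin0 : Real.sin (π * (a - b) / L) ≠ 0 := by
    intro h0'
    rw [h0', abs_zero] at hsin
    linarith
  have h1 := girardeauDensityMatrix_le_sqrt_div_sin hN hL hsin0
  have hsq : Real.sqrt (2 * |a - b| / L) ≤ Real.sqrt |Real.sin (π * (a - b) / L)| :=
    Real.sqrt_le_sqrt hsin
  have hsq0 : 0 < Real.sqrt (2 * |a - b| / L) := Real.sqrt_pos.2 hpos
  have hNpos : (0 : ℝ) < N := by exact_mod_cast hN
  calc girardeauDensityMatrix N L a b
      ≤ 2 * Real.exp 1 * Real.sqrt N / (L * Real.sqrt |Real.sin (π * (a - b) / L)|) := h1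
    _ ≤ 2 * Real.exp 1 * Real.sqrt N / (L * Real.sqrt (2 * |a - b| / L)) := by
        apply div_le_div_of_nonneg_left (by positivity) (by positivity)
        exact mul_le_mul_of_nonneg_left hsq hL.le
    _ = Real.exp 1 * (2 * Real.sqrt N / (L * Real.sqrt (2 * |a - b| / L))) := by ring
    _ = Real.exp 1 * Real.sqrt (2 * (N / L) / |a - b|) := by
        congr 1
        symm
        rw [Real.sqrt_eq_iff_mul_self_eq_of_pos (by positivity)]
        have hs1 : Real.sqrt (N : ℝ) * Real.sqrt N = N := Real.mul_self_sqrt hNpos.le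
        have hs2 : Real.sqrt (2 * |a - b| / L) * Real.sqrt (2 * |a - b| / L) = 2 * |a - b| / L :=
          Real.mul_self_sqrt hpos.le
        calc 2 * Real.sqrt N / (L * Real.sqrt (2 * |a - b| / L)) *
              (2 * Real.sqrt N / (L * Real.sqrt (2 * |a - b| / L)))
            = 4 * (Real.sqrt (N : ℝ) * Real.sqrt N) /
                (L ^ 2 * (Real.sqrt (2 * |a - b| / L) * Real.sqrt (2 * |a - b| / L))) := by
              ring
          _ = 4 * N / (L ^ 2 * (2 * |a - b| / L)) := by rw [hs1, hs2]
          _ = 2 * (N / L) / |a - b| := by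
              field_simp
              ring

/-- **Antipodal coherence**: `ρ_N(a, a + L/2) ≤ 2e√N/L = 2eρ̄/√N` (`ρ̄ = N/L`) for every
`N ≥ 1`, `L > 0` — the largest separation on the ring carries only `O(ρ̄/√N)` coherence.
[cite: ForresterEtAl2003, §2.1.4] -/
theorem girardeauDensityMatrix_antipodal_le {N : ℕ} (hN : 1 ≤ N) {L : ℝ} (hL : 0 < L) (a : ℝ) :
    girardeauDensityMatrix N L a (a + L / 2) ≤ 2 * Real.exp 1 * Real.sqrt N / L := by
  have harg : π * (a - (a + L / 2)) / L = -(π / 2) := by field_simp; ring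
  have hsin1 : |Real.sin (π * (a - (a + L / 2)) / L)| = 1 := by
    rw [harg, Real.sin_neg, Real.sin_pi_div_two, abs_neg, abs_one]
  have hsin0 : Real.sin (π * (a - (a + L / 2)) / L) ≠ 0 := by
    intro h0
    rw [h0, abs_zero] at hsin1
    exact zero_ne_one hsin1
  have h1 := girardeauDensityMatrix_le_sqrt_div_sin hN hL hsin0 (a := a) (b := a + L / 2)
  rwa [hsin1, Real.sqrt_one, mul_one] at h1

/-- **Antipodal coherence vanishes in the thermodynamic limit**: at fixed density `ρ > 0`, along
`L = N/ρ`, `ρ_N(0, L/2) ≤ 2eρ/√N → 0`. [cite: ForresterEtAl2003, §2.1.4] -/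
theorem tendsto_girardeauDensityMatrix_antipodal {ρ : ℝ} (hρ : 0 < ρ) :
    Tendsto (fun N : ℕ => girardeauDensityMatrix N (N / ρ) 0 (N / ρ / 2)) atTop (𝓝 0) := by
  have hbound : ∀ N : ℕ, 1 ≤ N →
      girardeauDensityMatrix N (N / ρ) 0 (N / ρ / 2) ≤ 2 * Real.exp 1 * ρ / Real.sqrt N := by
    intro N hN
    have hNpos : (0 : ℝ) < N := by exact_mod_cast hN
    have hL : (0 : ℝ) < N / ρ := div_pos hNpos hρ
    have h := girardeauDensityMatrix_antipodal_le hN hL 0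
    rw [zero_add] at h
    calc girardeauDensityMatrix N (N / ρ) 0 (N / ρ / 2) ≤ 2 * Real.exp 1 * Real.sqrt N / (N / ρ) := h
      _ = 2 * Real.exp 1 * ρ / Real.sqrt N := by
          have hs : Real.sqrt (N : ℝ) * Real.sqrt N = N := Real.mul_self_sqrt hNpos.le
          have hs0 : 0 < Real.sqrt (N : ℝ) := Real.sqrt_pos.2 hNpos
          rw [div_eq_div_iff hL.ne' hs0.ne', mul_assoc (2 * Real.exp 1), hs]
          field_simp
  have hupper : Tendsto (fun N : ℕ => 2 * Real.exp 1 * ρ / Real.sqrt N) atTop (𝓝 0) := by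
    have hsqrt : Tendsto (fun N : ℕ => Real.sqrt (N : ℝ)) atTop atTop :=
      Real.tendsto_sqrt_atTop.comp tendsto_natCast_atTop_atTop
    have := hsqrt.inv_tendsto_atTop.const_mul (2 * Real.exp 1 * ρ)
    rw [mul_zero] at this
    refine this.congr' ?_
    filter_upwards with N
    simp only [Pi.inv_apply, div_eq_mul_inv]
  refine tendsto_of_tendsto_of_tendsto_of_le_of_le' tendsto_const_nhds hupper ?_ ?_
  · filter_upwards with N
    exact girardeauDensityMatrix_nonneg N _ _ _
  · filter_upwards [eventually_ge_atTop 1] with N hN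
    exact hbound N hN

end Literature.Barriers.AtomisticToContinuum.BoseGas

end
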